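import Summits.QuantumAdvantage.QuantumAdvantage.Theorems.CubicForrelationSignedExactCubicForrelationNotPrBPPStubNoTrapTemplateLemmas2
import Summits.QuantumAdvantage.QuantumAdvantage.Theorems.CubicForrelationSignedCubicForrelationNotPrBPPStubKernelNormalFormDegree

/-!
# No-trap theorem, transport to Maiorana–McFarland orbits — helper lemmas, part 1: covariance

Helper file for stub `stub_noTrapTransport` of line `dual-pingpong-frame`, crux stmt-QuantumAdvantage-13932
(`SignedExactCubicForrelationNotPrBPP`, route `QuantumAdvantage/CubicForrelation`). No definitions. GENERIC
covariance bookkeeping for the GROW finder's notions (closed pairs `ClosedF f A B`, orthogonality, M-subspaces)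
under an affine change of variables `f₀(x) = f(P x ⊕ z₀) ⊕ λ(x)` (`P` additive, `λ` additive):

* linear algebra of additive maps of `𝔽₂ⁿ` in the tree's bit-vector vocabulary: `P 0 = 0` (`map_zeroVec`),
  nondegeneracy of the inner product bit (`eq_of_bdot_eq`), existence of the ADJOINT `Q` of an additive `P`,
  `P x · y = x · Q y` (`exists_adjoint`, from `QuadSampler.additive_eq_sum`), additivity of adjoints, images of
  subspaces;
* degrees: an additive Boolean function is affine (`isDegLeFun_one_of_additive`), so `f ∘ (x ↦ P x ⊕ z₀)` keeps the
  degree of `f` (`isDegLeFun_comp_affine`, via `knf_isDegLeFun_comp`);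
* second differences are covariant, `D_u D_v f₀ (x) = D_{Pu} D_{Pv} f (P x ⊕ z₀)` (`D2_transport`), and hence — for
  `f` of degree `≤ 3`, whose third differences are base-point free and represented by row vectors
  (`NoTrap.D3_basefree`, `NoTrap.D3_repr`) — the slice rows of `f₀` are the `Q`-images of the slice rows of `f` and
  the offsets of `f₀` are represented by the `Q`-images of the representing vectors of `f`: a pair `(A, B)` closed for
  `f` pulls back to a pair `(A₀, B₀)` closed for `f₀` whenever `P A₀ ⊆ A` and `Q B ⊆ B₀` (`closed_transport`,
  `closedF_transport`).

References: C. Carlet, *Boolean Functions for Cryptography and Coding Theory*, CUP 2020, §2.2.2 (derivatives, affine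
equivalence) [Carlet2020]; R. O'Donnell, *Analysis of Boolean Functions*, CUP 2014, §1.4, §3.3 [ODonnell2014].
-/

noncomputable section

set_option linter.dupNamespace false -- D-0017: single-problem summit ⇒ `QuantumAdvantage.QuantumAdvantage` by design

namespace Summit.QuantumAdvantage.QuantumAdvantage.Theorems.SignedExactCubicForrelationNotPrBPP

open Finset
open Literature.Computability.Complexity Literature.Computability.QuantumComplexity
open Literature.Computability.QuantumComplexity.BuzetChailloux (bxor zeroVec bxor_self bxor_comm
  bxor_zeroVec zeroVec_bxor)
open Literature.Computability.Complexity.BLR (toZ toZ_xor toZ_and toZ_injective)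
open PolarGeometry (toZ_bdot bdot_comm bdot_bxor_left bdot_bxor_right)
open NoTrap (bdot_unit bdot_zeroVec D3_basefree D3_repr D_zeroVec_eq)
open Summit.QuantumAdvantage.QuantumAdvantage.Theorems.SignedCubicForrelationNotPrBPP (knf_isDegLeFun_comp
  knf_isDegLeFun_xor_const knf_isDegLeFun_ip)

namespace Covariance

variable {m n k : ℕ}

/-! ### Additive maps of bit vectors: zero, nondegeneracy of the inner product, adjoints -/

/-- An additive map sends `0` to `0`. [folklore] -/
theorem map_zeroVec {P : (Fin n → Bool) → (Fin k → Bool)} (hP : ∀ x y, P (bxor x y) = bxor (P x) (P y)) :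
    P zeroVec = zeroVec := by
  have h := hP zeroVec zeroVec
  rw [bxor_self, bxor_self] at h
  exact h

/-- `0 · y = 0`. [folklore] -/
theorem zeroVec_bdot (y : Fin n → Bool) :
    (univ.filter fun i => (zeroVec : Fin n → Bool) i && y i).card.bodd = false := by
  rw [bdot_comm]; exact bdot_zeroVec y

/-- **Nondegeneracy of the inner product bit**: a vector is determined by its pairings `x · y`. [folklore] -/
theorem eq_of_bdot_eq {y y' : Fin n → Bool}
    (h : ∀ x : Fin n → Bool,
      (univ.filter fun i => x i && y i).card.bodd = (univ.filter fun i => x i && y' i).card.bodd) :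
    y = y' := by
  funext i
  have := h (fun j => decide (j = i))
  rwa [bdot_unit, bdot_unit] at this

/-- **Adjoints.** Every additive map `P : 𝔽₂ⁿ → 𝔽₂ᵏ` has an adjoint `Q : 𝔽₂ᵏ → 𝔽₂ⁿ` for the inner product bit,
`P x · y = x · Q y` (namely `(Q y)ᵢ = P eᵢ · y`; an additive functional is the inner product with its values on
the unit vectors, `QuadSampler.additive_eq_sum`). [cite: ODonnell2014, §1.4] -/
theorem exists_adjoint (P : (Fin n → Bool) → (Fin k → Bool)) (hP : ∀ x y, P (bxor x y) = bxor (P x) (P y)) :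
    ∃ Q : (Fin k → Bool) → (Fin n → Bool), ∀ x y,
      (univ.filter fun i => P x i && y i).card.bodd = (univ.filter fun i => x i && Q y i).card.bodd := by
  refine ⟨fun y i => (univ.filter fun l => P (fun c => decide (c = i)) l && y l).card.bodd, fun x y => ?_⟩
  have h0 : P zeroVec = zeroVec := map_zeroVec hP
  have hadd := QuadSampler.additive_eq_sum (fun x => toZ (univ.filter fun i => P x i && y i).card.bodd)
    (by show toZ (univ.filter fun i => P zeroVec i && y i).card.bodd = 0
        rw [h0, zeroVec_bdot]; rfl)
    (fun x x' => by
      show toZ (univ.filter fun i => P (bxor x x') i && y i).card.bodd = _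
      rw [hP, bdot_bxor_left, toZ_xor]) x
  apply toZ_injective
  rw [hadd, toZ_bdot]
  refine sum_congr rfl fun i _ => ?_
  rw [toZ_and]
  rfl

/-- **Adjoints are additive** (by nondegeneracy). [folklore] -/
theorem adjoint_additive {P : (Fin n → Bool) → (Fin k → Bool)} {Q : (Fin k → Bool) → (Fin n → Bool)}
    (hQ : ∀ x y, (univ.filter fun i => P x i && y i).card.bodd = (univ.filter fun i => x i && Q y i).card.bodd) :
    ∀ y y', Q (bxor y y') = bxor (Q y) (Q y') := by
  intro y y'
  refine eq_of_bdot_eq fun x => ?_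
  rw [← hQ, bdot_bxor_right, bdot_bxor_right, hQ, hQ]

/-- The inverse of an additive bijection is additive. [folklore] -/
theorem inverse_additive {P Pi : (Fin n → Bool) → (Fin n → Bool)} (hP : ∀ x y, P (bxor x y) = bxor (P x) (P y))
    (h1 : ∀ x, P (Pi x) = x) (h2 : ∀ x, Pi (P x) = x) : ∀ y y', Pi (bxor y y') = bxor (Pi y) (Pi y') := by
  intro y y'
  have e : P (Pi (bxor y y')) = P (bxor (Pi y) (Pi y')) := by rw [h1, hP, h1, h1]
  have := congrArg Pi e
  rwa [h2, h2] at this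

/-- The image of a subspace (a finset containing `0` and closed under `⊕`) under an additive map is a subspace.
[folklore] -/
theorem isSub_image {P : (Fin n → Bool) → (Fin k → Bool)} (hP : ∀ x y, P (bxor x y) = bxor (P x) (P y))
    {A : Finset (Fin n → Bool)} (hA : zeroVec ∈ A ∧ ∀ x ∈ A, ∀ y ∈ A, bxor x y ∈ A) :
    zeroVec ∈ A.image P ∧ ∀ x ∈ A.image P, ∀ y ∈ A.image P, bxor x y ∈ A.image P := by
  refine ⟨mem_image.2 ⟨zeroVec, hA.1, map_zeroVec hP⟩, fun x hx y hy => ?_⟩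
  obtain ⟨u, hu, rfl⟩ := mem_image.1 hx
  obtain ⟨v, hv, rfl⟩ := mem_image.1 hy
  exact mem_image.2 ⟨bxor u v, hA.2 u hu v hv, hP u v⟩

/-! ### Degrees under affine substitutions -/

/-- **An additive Boolean function is affine** (indeed linear: it is the inner product `x ↦ x · κ` with
`κⱼ = g(eⱼ)`), hence of algebraic degree `≤ 1`. [cite: Carlet2020, §2.2.2] -/
theorem isDegLeFun_one_of_additive {g : (Fin n → Bool) → Bool} (hg : ∀ x y, g (bxor x y) = (g x ^^ g y)) :
    IsDegLeFun 1 g := by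
  have h0 : g zeroVec = false := by
    have := hg zeroVec zeroVec
    rw [bxor_self] at this
    revert this
    cases g zeroVec <;> decide
  have key : ∀ x, g x = (univ.filter fun i => x i && (fun j => g (fun c => decide (c = j))) i).card.bodd := by
    intro x
    apply toZ_injective
    rw [toZ_bdot]
    have hadd := QuadSampler.additive_eq_sum (fun x => toZ (g x))
      (by show toZ (g zeroVec) = 0
          rw [h0]; rfl)
      (fun x y => by
        show toZ (g (bxor x y)) = _
        rw [hg, toZ_xor]) x
    rw [hadd]
    refine sum_congr rfl fun j _ => ?_
    rw [toZ_and]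
    rfl
  have e : g = fun x => decide (Odd (univ.filter fun i => x i && (fun j => g (fun c => decide (c = j))) i).card) := by
    funext x
    rw [key]
    apply toZ_injective
    rw [← PolarGeometry.natCast_eq_toZ_bodd, BLR.toZ_decide_odd]
  rw [e]
  exact knf_isDegLeFun_ip _

/-- **Affine substitutions keep the degree**: if `f` has degree `≤ d` and `P` is additive then
`x ↦ f (P x ⊕ z₀)` has degree `≤ d`. [cite: Carlet2020, §2.2.2] -/
theorem isDegLeFun_comp_affine {d : ℕ} {f : (Fin k → Bool) → Bool} (hf : IsDegLeFun d f)
    {P : (Fin n → Bool) → (Fin k → Bool)} (hP : ∀ x y, P (bxor x y) = bxor (P x) (P y)) (z₀ : Fin k → Bool) :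
    IsDegLeFun d (fun x => f (bxor (P x) z₀)) := by
  refine knf_isDegLeFun_comp hf (fun x => bxor (P x) z₀) (fun j => ?_)
  show IsDegLeFun 1 (fun x => P x j ^^ z₀ j)
  refine knf_isDegLeFun_xor_const (isDegLeFun_one_of_additive fun x y => ?_) (z₀ j)
  show P (bxor x y) j = (P x j ^^ P y j)
  rw [hP]

/-- The coordinates of the block embedding `x ↦ (x ‖ c)` are affine (companion of
`NearExactIsExact.fc_deg_coord_append_left`, which treats `y ↦ (c ‖ y)`). [folklore] -/
theorem isDegLeFun_append_left_coord (c : Fin n → Bool) (j : Fin (m + n)) :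
    IsDegLeFun 1 (fun x : Fin m → Bool => Fin.append x c j) := by
  refine Fin.addCases (fun i => ?_) (fun i => ?_) j
  · simp only [Fin.append_left]; exact isDegLeFun_apply i le_rfl
  · simp only [Fin.append_right]; exact isDegLeFun_const 1 (c i)

/-! ### Covariance of second differences and of closed pairs -/

/-- **Second differences are covariant**: for `f₀(x) = f(P x ⊕ z₀) ⊕ λ(x)` with `P`, `λ` additive,
`D_u D_v f₀ (x) = D_{Pu} D_{Pv} f (P x ⊕ z₀)` (the affine part drops out). [cite: Carlet2020, §2.2.2] -/
theorem D2_transport {f : (Fin k → Bool) → Bool} {f₀ : (Fin n → Bool) → Bool}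
    {P : (Fin n → Bool) → (Fin k → Bool)} (hP : ∀ x y, P (bxor x y) = bxor (P x) (P y))
    {z₀ : Fin k → Bool} {lam : (Fin n → Bool) → Bool} (hlam : ∀ x y, lam (bxor x y) = (lam x ^^ lam y))
    (hf₀ : ∀ x, f₀ x = (f (bxor (P x) z₀) ^^ lam x))
    (D : (Fin k → Bool) → (Fin k → Bool) → (Fin k → Bool) → Bool)
    (D₀ : (Fin n → Bool) → (Fin n → Bool) → (Fin n → Bool) → Bool)
    (hD : ∀ u v x, D u v x = (f x ^^ f (bxor x u) ^^ f (bxor x v) ^^ f (bxor x (bxor u v))))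
    (hD₀ : ∀ u v x, D₀ u v x = (f₀ x ^^ f₀ (bxor x u) ^^ f₀ (bxor x v) ^^ f₀ (bxor x (bxor u v)))) :
    ∀ u v x, D₀ u v x = D (P u) (P v) (bxor (P x) z₀) := by
  intro u v x
  have e2 : f₀ (bxor x u) = (f (bxor (bxor (P x) z₀) (P u)) ^^ (lam x ^^ lam u)) := by
    rw [hf₀, hP, hlam, show bxor (bxor (P x) (P u)) z₀ = bxor (bxor (P x) z₀) (P u) from by
      show (P x + P u) + z₀ = (P x + z₀) + P u
      abel]
  have e3 : f₀ (bxor x v) = (f (bxor (bxor (P x) z₀) (P v)) ^^ (lam x ^^ lam v)) := by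
    rw [hf₀, hP, hlam, show bxor (bxor (P x) (P v)) z₀ = bxor (bxor (P x) z₀) (P v) from by
      show (P x + P v) + z₀ = (P x + z₀) + P v
      abel]
  have e4 : f₀ (bxor x (bxor u v)) = (f (bxor (bxor (P x) z₀) (bxor (P u) (P v))) ^^ (lam x ^^ (lam u ^^ lam v))) := by
    rw [hf₀, hP, hP, hlam, hlam, show bxor (bxor (P x) (bxor (P u) (P v))) z₀ =
      bxor (bxor (P x) z₀) (bxor (P u) (P v)) from by
      show (P x + (P u + P v)) + z₀ = (P x + z₀) + (P u + P v)
      abel]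
  rw [hD₀, hD, hf₀ x, e2, e3, e4]
  generalize f (bxor (P x) z₀) = A
  generalize f (bxor (bxor (P x) z₀) (P u)) = B
  generalize f (bxor (bxor (P x) z₀) (P v)) = C
  generalize f (bxor (bxor (P x) z₀) (bxor (P u) (P v))) = E
  generalize lam x = X; generalize lam u = Y; generalize lam v = Z
  revert A B C E X Y Z; decide

/-- **Closed pairs are covariant** (second-difference form). Let `f` have degree `≤ 3` and let the second
differences of `f₀` be those of `f` transported by an additive surjection `P` with adjoint `Q`
(`D_u D_v f₀ (x) = D_{Pu} D_{Pv} f (P x ⊕ z₀)`, `P x · y = x · Q y`). If the slice rows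
`k ↦ D_{e_k} D_s D_y f (0)` (`s ∈ A`) lie in `B` and the offsets `r ↦ D_s D_r f (0)` on `rad B_s` are represented
by vectors of `B`, then the same holds for `f₀` with any `(A₀, B₀)` such that `P A₀ ⊆ A`, `Q B ⊆ B₀`: the rows of
`f₀` are the `Q`-images of rows of `f` (third differences of a cubic are base-point free and trilinear), and an
offset of `f₀` at `s` is represented by `Q ℓ` where `ℓ` represents the offset of `f` at `P s`. [cite: Carlet2020, §2.2.2] -/
theorem closed_transport {f : (Fin n → Bool) → Bool} {f₀ : (Fin n → Bool) → Bool} (hf : IsDegLeFun 3 f)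
    (D D₀ : (Fin n → Bool) → (Fin n → Bool) → (Fin n → Bool) → Bool)
    (hD : ∀ u v x, D u v x = (f x ^^ f (bxor x u) ^^ f (bxor x v) ^^ f (bxor x (bxor u v))))
    (hD₀ : ∀ u v x, D₀ u v x = (f₀ x ^^ f₀ (bxor x u) ^^ f₀ (bxor x v) ^^ f₀ (bxor x (bxor u v))))
    {P Q : (Fin n → Bool) → (Fin n → Bool)} {z₀ : Fin n → Bool}
    (H : ∀ u v x, D₀ u v x = D (P u) (P v) (bxor (P x) z₀))
    (hP : ∀ x y, P (bxor x y) = bxor (P x) (P y)) (hPs : ∀ y, ∃ x, P x = y)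
    (hQ : ∀ x y, (univ.filter fun i => P x i && y i).card.bodd = (univ.filter fun i => x i && Q y i).card.bodd)
    {A B A₀ B₀ : Finset (Fin n → Bool)} (hA : ∀ s ∈ A₀, P s ∈ A) (hB : ∀ ℓ ∈ B, Q ℓ ∈ B₀)
    (hrow : ∀ s ∈ A, ∀ y, (fun k => (D s y zeroVec ^^ D s y (fun j => decide (j = k)))) ∈ B)
    (hoff : ∀ s ∈ A, ∃ ℓ ∈ B, ∀ r, (∀ y z, (D s r z ^^ D s r (bxor z y)) = false) →
      (f r ^^ f (bxor r s) ^^ f zeroVec ^^ f s) = (univ.filter fun i => ℓ i && r i).card.bodd) :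
    (∀ s ∈ A₀, ∀ y, (fun k => (D₀ s y zeroVec ^^ D₀ s y (fun j => decide (j = k)))) ∈ B₀) ∧
    (∀ s ∈ A₀, ∃ ℓ ∈ B₀, ∀ r, (∀ y z, (D₀ s r z ^^ D₀ s r (bxor z y)) = false) →
      (f₀ r ^^ f₀ (bxor r s) ^^ f₀ zeroVec ^^ f₀ s) = (univ.filter fun i => ℓ i && r i).card.bodd) := by
  have hP0 : P zeroVec = zeroVec := map_zeroVec hP
  -- third differences of `f₀` at `0` are transported third differences of `f`
  have h3 : ∀ s r w, (D₀ s r zeroVec ^^ D₀ s r w) = (D (P s) (P r) zeroVec ^^ D (P s) (P r) (P w)) := by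
    intro s r w
    rw [H, H, hP0, zeroVec_bxor, bxor_comm (P w) z₀]
    exact D3_basefree hf D hD (P s) (P r) (P w) z₀
  constructor
  · intro s hs y
    have hmem := hB _ (hrow (P s) (hA s hs) (P y))
    have e : (fun k => (D₀ s y zeroVec ^^ D₀ s y (fun j => decide (j = k)))) =
        Q (fun k => (D (P s) (P y) zeroVec ^^ D (P s) (P y) (fun j => decide (j = k)))) := by
      funext k
      rw [h3, D3_repr hf D hD (P s) (P y) (P (fun j => decide (j = k))), bdot_comm, hQ, bdot_unit]
    rw [e]
    exact hmem
  · intro s hs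
    obtain ⟨ℓ, hℓB, hℓ⟩ := hoff (P s) (hA s hs)
    refine ⟨Q ℓ, hB ℓ hℓB, fun r hr => ?_⟩
    have hrad : ∀ y z, (D (P s) (P r) z ^^ D (P s) (P r) (bxor z y)) = false := by
      intro y z
      obtain ⟨x, rfl⟩ := hPs y
      rw [D3_basefree hf D hD, ← h3]
      have := hr x zeroVec
      rwa [zeroVec_bxor] at this
    rw [← D_zeroVec_eq D₀ hD₀ s r, H, hP0, zeroVec_bxor]
    have hc : D (P s) (P r) z₀ = D (P s) (P r) zeroVec := by
      have := hrad z₀ zeroVec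
      rw [zeroVec_bxor] at this
      revert this
      generalize D (P s) (P r) zeroVec = A
      generalize D (P s) (P r) z₀ = B
      revert A B; decide
    rw [hc, D_zeroVec_eq D hD, hℓ (P r) hrad, bdot_comm ℓ (P r), hQ]
    exact bdot_comm _ _

/-- **Closed pairs are covariant** (tree vocabulary = the line's `ClosedF` unfolded). For `f` of degree `≤ 3`,
`f₀(x) = f(P x ⊕ z₀) ⊕ λ(x)` with `P` an additive surjection with adjoint `Q` and `λ` additive: if `(A, B)` is
closed for `f` then every `(A₀, B₀)` with `P A₀ ⊆ A`, `Q B ⊆ B₀` is closed for `f₀`. [cite: Carlet2020, §2.2.2] -/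
theorem closedF_transport (f f₀ : (Fin n → Bool) → Bool) (hf : IsDegLeFun 3 f)
    (P Q : (Fin n → Bool) → (Fin n → Bool)) (z₀ : Fin n → Bool) (lam : (Fin n → Bool) → Bool)
    (hP : ∀ x y, P (bxor x y) = bxor (P x) (P y)) (hPs : ∀ y, ∃ x, P x = y)
    (hQ : ∀ x y, (univ.filter fun i => P x i && y i).card.bodd = (univ.filter fun i => x i && Q y i).card.bodd)
    (hlam : ∀ x y, lam (bxor x y) = (lam x ^^ lam y)) (hf₀ : ∀ x, f₀ x = (f (bxor (P x) z₀) ^^ lam x))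
    (A B A₀ B₀ : Finset (Fin n → Bool)) (hA : ∀ s ∈ A₀, P s ∈ A) (hB : ∀ ℓ ∈ B, Q ℓ ∈ B₀)
    (hcl : (∀ s ∈ A, ∀ y : Fin n → Bool, (fun k => (f zeroVec ^^ f (bxor zeroVec s) ^^ f (bxor zeroVec y) ^^ f (bxor zeroVec (bxor s y))) ^^ (f (fun j => decide (j = k)) ^^ f (bxor (fun j => decide (j = k)) s) ^^ f (bxor (fun j => decide (j = k)) y) ^^ f (bxor (fun j => decide (j = k)) (bxor s y)))) ∈ B) ∧ (∀ s ∈ A, ∃ ℓ ∈ B, ∀ r : Fin n → Bool, (∀ y z : Fin n → Bool, ((f z ^^ f (bxor z s) ^^ f (bxor z r) ^^ f (bxor z (bxor s r))) ^^ (f (bxor z y) ^^ f (bxor (bxor z y) s) ^^ f (bxor (bxor z y) r) ^^ f (bxor (bxor z y) (bxor s r)))) = false) → (f r ^^ f (bxor r s) ^^ f zeroVec ^^ f s) = ((Finset.univ.filter fun i => ℓ i && r i).card).bodd)) :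
    (∀ s ∈ A₀, ∀ y : Fin n → Bool, (fun k => (f₀ zeroVec ^^ f₀ (bxor zeroVec s) ^^ f₀ (bxor zeroVec y) ^^ f₀ (bxor zeroVec (bxor s y))) ^^ (f₀ (fun j => decide (j = k)) ^^ f₀ (bxor (fun j => decide (j = k)) s) ^^ f₀ (bxor (fun j => decide (j = k)) y) ^^ f₀ (bxor (fun j => decide (j = k)) (bxor s y)))) ∈ B₀) ∧ (∀ s ∈ A₀, ∃ ℓ ∈ B₀, ∀ r : Fin n → Bool, (∀ y z : Fin n → Bool, ((f₀ z ^^ f₀ (bxor z s) ^^ f₀ (bxor z r) ^^ f₀ (bxor z (bxor s r))) ^^ (f₀ (bxor z y) ^^ f₀ (bxor (bxor z y) s) ^^ f₀ (bxor (bxor z y) r) ^^ f₀ (bxor (bxor z y) (bxor s r)))) = false) → (f₀ r ^^ f₀ (bxor r s) ^^ f₀ zeroVec ^^ f₀ s) = ((Finset.univ.filter fun i => ℓ i && r i).card).bodd) := by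
  obtain ⟨D, hD⟩ : ∃ D : (Fin n → Bool) → (Fin n → Bool) → (Fin n → Bool) → Bool,
      ∀ u v x, D u v x = (f x ^^ f (bxor x u) ^^ f (bxor x v) ^^ f (bxor x (bxor u v))) := ⟨_, fun _ _ _ => rfl⟩
  obtain ⟨D₀, hD₀⟩ : ∃ D₀ : (Fin n → Bool) → (Fin n → Bool) → (Fin n → Bool) → Bool,
      ∀ u v x, D₀ u v x = (f₀ x ^^ f₀ (bxor x u) ^^ f₀ (bxor x v) ^^ f₀ (bxor x (bxor u v))) := ⟨_, fun _ _ _ => rfl⟩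
  simp only [← hD] at hcl
  simp only [← hD₀]
  exact closed_transport hf D D₀ hD hD₀ (D2_transport hP hlam hf₀ D D₀ hD hD₀) hP hPs hQ hA hB hcl.1 hcl.2

end Covariance

/-- **Closed pairs are covariant** (registered brick `noTrapTransport_closedF` of stub `stub_noTrapTransport`, line
`dual-pingpong-frame`, crux stmt-QuantumAdvantage-13932; tree vocabulary = the line's `ClosedF` unfolded): for `f` of
degree `≤ 3` and `f₀(x) = f(P x ⊕ z₀) ⊕ λ(x)` with `P` an additive surjection with adjoint `Q` and `λ` additive, a pair
`(A, B)` closed for `f` pulls back to any `(A₀, B₀)` with `P A₀ ⊆ A`, `Q B ⊆ B₀`, closed for `f₀`. [cite: Carlet2020, §2.2.2] -/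
theorem noTrapTransport_closedF : ∀ {n : ℕ} (f f₀ : (Fin n → Bool) → Bool) (P Q : (Fin n → Bool) → (Fin n → Bool)) (z₀ : Fin n → Bool) (lam : (Fin n → Bool) → Bool) (A B A₀ B₀ : Finset (Fin n → Bool)), IsDegLeFun 3 f → (∀ x y : Fin n → Bool, P (bxor x y) = bxor (P x) (P y)) → (∀ y : Fin n → Bool, ∃ x, P x = y) → (∀ x y : Fin n → Bool, ((Finset.univ.filter fun i => P x i && y i).card).bodd = ((Finset.univ.filter fun i => x i && Q y i).card).bodd) → (∀ x y : Fin n → Bool, lam (bxor x y) = (lam x ^^ lam y)) → (∀ x : Fin n → Bool, f₀ x = (f (bxor (P x) z₀) ^^ lam x)) → (∀ s ∈ A₀, P s ∈ A) → (∀ ℓ ∈ B, Q ℓ ∈ B₀) → ((∀ s ∈ A, ∀ y : Fin n → Bool, (fun k => (f zeroVec ^^ f (bxor zeroVec s) ^^ f (bxor zeroVec y) ^^ f (bxor zeroVec (bxor s y))) ^^ (f (fun j => decide (j = k)) ^^ f (bxor (fun j => decide (j = k)) s) ^^ f (bxor (fun j => decide (j = k)) y) ^^ f (bxor (fun j =>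 decide (j = k)) (bxor s y)))) ∈ B) ∧ (∀ s ∈ A, ∃ ℓ ∈ B, ∀ r : Fin n → Bool, (∀ y z : Fin n → Bool, ((f z ^^ f (bxor z s) ^^ f (bxor z r) ^^ f (bxor z (bxor s r))) ^^ (f (bxor z y) ^^ f (bxor (bxor z y) s) ^^ f (bxor (bxor z y) r) ^^ f (bxor (bxor z y) (bxor s r)))) = false) → (f r ^^ f (bxor r s) ^^ f zeroVec ^^ f s) = ((Finset.univ.filter fun i => ℓ i && r i).card).bodd)) → ((∀ s ∈ A₀, ∀ y : Fin n → Bool, (fun k => (f₀ zeroVec ^^ f₀ (bxor zeroVec s) ^^ f₀ (bxor zeroVec y) ^^ f₀ (bxor zeroVec (bxor s y))) ^^ (f₀ (fun j => decide (j = k)) ^^ f₀ (bxor (fun j => decide (j = k)) s) ^^ f₀ (bxor (fun j => decide (j = k)) y) ^^ f₀ (bxor (fun j => decide (j = k)) (bxor s y)))) ∈ B₀) ∧ (∀ s ∈ A₀, ∃ ℓ ∈ B₀, ∀ r : Fin n → Bool, (∀ y z : Fin n → Bool, ((f₀ z ^^ f₀ (bxor z s) ^^ f₀ (bxor z r) ^^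 f₀ (bxor z (bxor s r))) ^^ (f₀ (bxor z y) ^^ f₀ (bxor (bxor z y) s) ^^ f₀ (bxor (bxor z y) r) ^^ f₀ (bxor (bxor z y) (bxor s r)))) = false) → (f₀ r ^^ f₀ (bxor r s) ^^ f₀ zeroVec ^^ f₀ s) = ((Finset.univ.filter fun i => ℓ i && r i).card).bodd)) :=
  fun f f₀ P Q z₀ lam A B A₀ B₀ hf hP hPs hQ hlam hf₀ hA hB hcl =>
    Covariance.closedF_transport f f₀ hf P Q z₀ lam hP hPs hQ hlam hf₀ A B A₀ B₀ hA hB hcl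

end Summit.QuantumAdvantage.QuantumAdvantage.Theorems.SignedExactCubicForrelationNotPrBPP

end
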